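import Literature.NumberTheory.LFunctions.VerjovskyCriterionSufficiencyProofs
import Literature.NumberTheory.LFunctions.HorocycleRHMellinShift
import Literature.NumberTheory.LFunctions.RHLittlewoodZetaBounds
import Literature.NumberTheory.LFunctions.RHZetaGrowthProofs
import Literature.NumberTheory.LFunctions.SelbergMollifierProofs
import Literature.NumberTheory.LFunctions.ZetaArgBacklundExplicit
import Literature.Analysis.Complex.VerticalLineShift
import HarnessLib

/-!
RH-CONDITIONAL lemmas (growth of `ζ` under RH) serving an RH-EQUIVALENT statement: Verjovsky's
Theorem B 1) for the printed class `C_c²(ℝ₊ˣ)` — the necessity half PROVED and the named fact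
`Verjovsky1994_thmB1` DISCHARGED; nothing here bears on the truth of RH.
# Verjovsky 1994, Theorem B 1): `RH ⟹ m_y(f) − m₀(f) = o(y^{3/4−ε})` for `f ∈ C_c²(ℝ₊ˣ)`

Companion of `VerjovskyCriterionSufficiencyProofs.lean` (the `←` half, any class) and
`VerjovskyCriterionC3Proofs.lean` (both halves for `C_c³` by the elementary road). Here the
printed road for `C_c²` (Verjovsky §2–§3, pp. 599–604; Zagier 1981 §1 for the model):

1. (§1) Mellin inversion with a contour shift for integrands with an integrable majorant
   `(1+|y|)^{-r}`, `r > 1` — the tree's `isBigO_nhdsGT_zero_of_mellin_continuation`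
   (`HorocycleRHMellinShift.lean`, majorant `1/(1+y²)`) re-run with the weaker majorant.
2. (§2) Under RH, `|ζ(w)| ≤ C |Im w|^{1−ε}` for `Re w ≥ −1/2 + 2ε`, `|Im w| ≥ 2` (tree:
   Littlewood–Titchmarsh 14.2 `LittlewoodRH.norm_riemannZeta_le_of_RH` for `Re w ≥ 3/4`,
   `SelbergMollifier.norm_riemannZeta_le_sqrt` ((4.11.2)) for `1/2 ≤ Re w ≤ 3/4`, the functional
   equation `ZetaArgBacklund.norm_riemannZeta_le_fe` to the left), and `|1/ζ(w)| ≤ C(1+|Im w|)^ε`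
   for `Re w ≥ 1/2 + 2ε` (tree `InvZetaRH.exists_norm_inv_riemannZeta_le`, Titchmarsh (14.2.6)).
3. (§3) `|f̃(w)| ≤ M/|Im w|²` on vertical strips for `f ∈ C_c²(ℝ₊ˣ)` (two integrations by parts:
   `f̃(w) = f̃''(w+2)/(w(w+1))`), and the Mellin transform of `y ↦ m_y(f)` for complex `f`:
   `∫₀^∞ m_y(f) y^{s−1} dy = 2 f̃(2s+2) ζ(2s+1)/ζ(2s+2)` (`re s > 0`; the real case is in the
   sufficiency file).
4. (§4) Assembly: with `κ = m₀(f) = f̃(2)/ζ(2)`, the function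
   `G(s) = 2f̃(2s)ζ(2s−1)/ζ(2s) − κ/((s−1)s)` is holomorphic on `re s > 1/4` under RH (the pole at
   `s = 1` cancels; written with the entire `zetaReg w = (w−1)ζ(w)` and a `dslope` at `s = 1`),
   equals `∫₀^∞ m_y(f) y^{s−2} dy − κ/((s−1)s)` for `re s > 1`, and is
   `O((1+|y|)^{−1−ε/2})` on `1/4 + ε ≤ re s ≤ 2`; §1 gives `m_y(f) − m₀(f) = O(y^{3/4−ε})`, whence
   `o(y^{3/4−ε'})` for every `ε' > ε`... i.e. for every `ε' > 0`.

* `Literature.NumberTheory.LFunctions.VerjovskyNecessity.verjovskyRate_of_RH` — RH ⟹ for every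
  `f ∈ C_c²(ℝ₊ˣ)` and `ε > 0`, `m_y(f) − m₀(f) = O(y^{3/4−ε})` at `0⁺`;
* `Literature.NumberTheory.LFunctions.Verjovsky1994_thmB1.mp_holds` — the `o`-form;
* `Literature.NumberTheory.LFunctions.Verjovsky1994_thmB1_holds` — the named fact, both halves.

## References

* A. Verjovsky, *Discrete measures and the Riemann hypothesis*, Kodai Math. J. 17 (1994)
  596–608, Thm B 1) p. 597, §§2–3 pp. 599–604 [Verjovsky1994].
* E. C. Titchmarsh, *The Theory of the Riemann Zeta-Function*, 2nd ed. (1986), Thm 14.2,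
  (4.11.2), (4.12.3) [Titchmarsh1986].
* D. Zagier, *Eisenstein series and the Riemann zeta function* (1981), §1 [Zagier1981].
-/

noncomputable section

open Real Complex MeasureTheory Set Filter Asymptotics Topology

namespace Literature.NumberTheory.LFunctions

namespace VerjovskyNecessity

/-! ### §1. Mellin inversion with a contour shift, integrable-majorant form -/

/-- Shifting the line of integration across a strip on which the integrand is holomorphic and
bounded by `C (1+|y|)^{-r}`, `r > 1`, uniformly. [cite: Zagier1981, §1 p. 279 (Mellin inversion and contour shift)] -/
theorem integral_vertical_eq_of_norm_le_rpow {g : ℂ → ℂ} {σ₁ σ₂ C r : ℝ} (hσ : σ₁ ≤ σ₂)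
    (hr : 1 < r) (hd : DifferentiableOn ℂ g (re ⁻¹' Icc σ₁ σ₂))
    (hb : ∀ x y : ℝ, x ∈ Icc σ₁ σ₂ → ‖g (x + y * I)‖ ≤ C * (1 + |y|) ^ (-r)) :
    ∫ y : ℝ, g (σ₁ + y * I) = ∫ y : ℝ, g (σ₂ + y * I) := by
  have hC0 : 0 ≤ C := by
    have h := (norm_nonneg _).trans (hb σ₁ 0 (left_mem_Icc.2 hσ))
    simpa using h
  have hmaj : Integrable fun y : ℝ ↦ (1 + ‖y‖) ^ (-r) :=
    integrable_one_add_norm (by simp; linarith)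
  have hint : ∀ x ∈ Icc σ₁ σ₂, Integrable fun y : ℝ ↦ g (x + y * I) := by
    intro x hx
    have hcont : Continuous fun y : ℝ ↦ g (x + y * I) := by
      refine hd.continuousOn.comp_continuous (by fun_prop) ?_
      intro y
      simpa using hx
    refine Integrable.mono' (hmaj.const_mul C) hcont.aestronglyMeasurable ?_
    filter_upwards with y
    simpa [Real.norm_eq_abs] using hb x y hx
  refine Literature.Analysis.Complex.integral_vertical_eq_of_differentiableOn hσ hd
    (hint σ₁ (left_mem_Icc.2 hσ)) (hint σ₂ (right_mem_Icc.2 hσ)) fun ε hε ↦ ?_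
  -- horizontal decay: `C (1+|T|)^{-r} ≤ C/|T| ≤ ε` once `|T| ≥ max (C/ε) 1`
  refine ⟨max (C / ε) 1, fun T hT x hx ↦ (hb x T hx).trans ?_⟩
  have hT1 : 1 ≤ |T| := (le_max_right _ _).trans hT
  have hT2 : C / ε ≤ |T| := (le_max_left _ _).trans hT
  have h1 : (1 + |T|) ^ (-r) ≤ (1 + |T|) ^ (-(1 : ℝ)) :=
    Real.rpow_le_rpow_of_exponent_le (by linarith) (by linarith)
  have h2 : (1 + |T|) ^ (-(1 : ℝ)) ≤ |T|⁻¹ := by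
    rw [Real.rpow_neg_one]
    exact inv_anti₀ (by positivity) (by linarith)
  have h3 : C * |T|⁻¹ ≤ ε := by
    rw [div_le_iff₀ hε] at hT2
    rw [mul_inv_le_iff₀ (by positivity)]
    linarith
  calc C * (1 + |T|) ^ (-r) ≤ C * |T|⁻¹ := by
        exact mul_le_mul_of_nonneg_left (h1.trans h2) hC0
    _ ≤ ε := h3

/-- **Mellin inversion with a contour shift, integrable-majorant form.** Let `φ` be continuous on
`(0,∞)` with `MellinConvergent φ (1+iy)` for all `y`, and suppose `G` is holomorphic on
`re s > a`, equal for `re s > 1` to `∫₀^∞ φ(t) t^{s-2} dt − κ/((s−1)s)`, and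
`‖G(x+iy)‖ ≤ C (1+|y|)^{-r}` (`r > 1`) for `σ' ≤ x ≤ 2`, `|y| ≥ T₀`, where `σ' ∈ (a,1)`, `σ' ≥ 0`.
Then `φ(y) − κ = O(y^{1−σ'})` as `y → 0⁺`. (The tree's `isBigO_nhdsGT_zero_of_mellin_continuation`
with the majorant `1/(1+y²)` replaced by `(1+|y|)^{-r}` and compactness for `|y| ≤ T₀`.)
[cite: Zagier1981, §1 p. 279 (Mellin inversion and contour shift)] -/
theorem isBigO_nhdsGT_zero_of_mellin_continuation_rpow {φ : ℝ → ℂ} {a σ' T₀ C r : ℝ} {κ : ℂ}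
    {G : ℂ → ℂ} (hφc : ContinuousOn φ (Ioi 0))
    (hφconv : ∀ y : ℝ, MellinConvergent φ (1 + y * I))
    (hσ' : a < σ') (hσ'0 : 0 ≤ σ') (hσ'1 : σ' < 1)
    (hG : DifferentiableOn ℂ G {s : ℂ | a < s.re})
    (hGeq : ∀ s : ℂ, 1 < s.re → G s = mellin φ (s - 1) - κ / ((s - 1) * s))
    (hr : 1 < r)
    (hGb : ∀ x y : ℝ, x ∈ Icc σ' 2 → T₀ ≤ |y| → ‖G (x + y * I)‖ ≤ C * (1 + |y|) ^ (-r)) :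
    (fun y : ℝ ↦ φ y - κ) =O[𝓝[>] 0] fun y : ℝ ↦ y ^ (1 - σ') := by
  -- a uniform bound on the whole strip: compactness for `|y| ≤ T₁`
  set T₁ : ℝ := max T₀ 0 + 1 with hT₁
  have hT₁0 : 0 < T₁ := by rw [hT₁]; linarith [le_max_right T₀ 0]
  set K : Set ℂ := Icc σ' 2 ×ℂ Icc (-T₁) T₁ with hK
  have hKc : IsCompact K :=
    Metric.isCompact_of_isClosed_isBounded (isClosed_Icc.reProdIm isClosed_Icc)
      ((Metric.isBounded_Icc σ' 2).reProdIm (Metric.isBounded_Icc (-T₁) T₁))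
  have hKsub : K ⊆ {s : ℂ | a < s.re} := fun s hs ↦ hσ'.trans_le (mem_reProdIm.1 hs).1.1
  obtain ⟨B, hB⟩ := hKc.exists_bound_of_continuousOn (hG.continuousOn.mono hKsub)
  have hB0 : 0 ≤ B := by
    have hmem : ((σ' : ℂ)) ∈ K := by
      refine mem_reProdIm.2 ⟨?_, ?_⟩
      · simp only [ofReal_re]; exact ⟨le_rfl, by linarith⟩
      · simp only [ofReal_im]; exact ⟨by linarith, by linarith⟩
    exact (norm_nonneg _).trans (hB _ hmem)
  have hC0 : 0 ≤ C := by
    have h := hGb σ' T₁ ⟨le_rfl, by linarith⟩ (by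
      rw [abs_of_pos hT₁0, hT₁]; linarith [le_max_left T₀ 0])
    have h0 : 0 < (1 + |T₁|) ^ (-r) := Real.rpow_pos_of_pos (by positivity) _
    nlinarith [norm_nonneg (G (σ' + T₁ * I))]
  set C' : ℝ := C + B * (1 + T₁) ^ r with hC'
  have hC'0 : 0 ≤ C' := by positivity
  have hGb' : ∀ x y : ℝ, x ∈ Icc σ' 2 → ‖G (x + y * I)‖ ≤ C' * (1 + |y|) ^ (-r) := by
    intro x y hx
    have hpos : 0 < (1 + |y|) ^ (-r) := Real.rpow_pos_of_pos (by positivity) _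
    rcases le_or_gt T₁ |y| with hy | hy
    · have hT₀y : T₀ ≤ |y| := by
        have : T₀ ≤ T₁ := by rw [hT₁]; linarith [le_max_left T₀ 0]
        exact this.trans hy
      calc ‖G (x + y * I)‖ ≤ C * (1 + |y|) ^ (-r) := hGb x y hx hT₀y
        _ ≤ C' * (1 + |y|) ^ (-r) := by
            gcongr; rw [hC']; nlinarith [Real.rpow_nonneg (by positivity : (0:ℝ) ≤ 1 + T₁) r]
    · have hmem : (x : ℂ) + y * I ∈ K := by
        refine mem_reProdIm.2 ⟨?_, ?_⟩
        · simpa using hx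
        · have : |y| ≤ T₁ := hy.le
          simpa using abs_le.1 this
      have h1 : ‖G (x + y * I)‖ ≤ B := hB _ hmem
      -- `B ≤ B (1+T₁)^r (1+|y|)^{-r}` since `(1+|y|)^{-r} ≥ (1+T₁)^{-r}`
      have h2 : (1 + T₁) ^ (-r) ≤ (1 + |y|) ^ (-r) := by
        rw [Real.rpow_neg (by positivity), Real.rpow_neg (by positivity)]
        exact inv_anti₀ (Real.rpow_pos_of_pos (by positivity) _)
          (Real.rpow_le_rpow (by positivity) (by linarith) (by linarith))
      have h3 : B ≤ B * (1 + T₁) ^ r * (1 + |y|) ^ (-r) := by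
        have e : B = B * (1 + T₁) ^ r * (1 + T₁) ^ (-r) := by
          rw [Real.rpow_neg (by positivity), mul_assoc,
            mul_inv_cancel₀ (Real.rpow_pos_of_pos (by positivity) _).ne', mul_one]
        conv_lhs => rw [e]
        exact mul_le_mul_of_nonneg_left h2 (by positivity)
      calc ‖G (x + y * I)‖ ≤ B * (1 + T₁) ^ r * (1 + |y|) ^ (-r) := h1.trans h3
        _ ≤ C' * (1 + |y|) ^ (-r) := by gcongr; rw [hC']; linarith
  -- the tent `(1 - t)⁺` (Mellin transform `1/(s(s+1))`, tree `hasMellin_oneSub_indicator`)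
  set ψ : ℝ → ℂ := (Ioc 0 1).indicator fun t : ℝ ↦ (1 : ℂ) - t with hψ
  have hψmem : ∀ t : ℝ, t ∈ Ioc (0 : ℝ) 1 → ψ t = 1 - t := fun t ht ↦ by
    simp [hψ, indicator_of_mem ht]
  set f : ℝ → ℂ := fun t ↦ φ t - κ • ψ t with hf
  have hmellin : ∀ y : ℝ, MellinConvergent f (1 + y * I) ∧
      mellin f (1 + y * I) = G (2 + y * I) := by
    intro y
    have hφ := hφconv y
    have ht := hasMellin_oneSub_indicator (s := 1 + y * I) (by simp)
    have hsub := hasMellin_sub hφ (ht.1.const_smul κ)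
    refine ⟨hsub.1, ?_⟩
    rw [hsub.2, mellin_const_smul, ht.2, hGeq (2 + y * I) (by simp)]
    have e1 : (2 : ℂ) + y * I - 1 = 1 + y * I := by ring
    have e2 : (1 : ℂ) + y * I + 1 = 2 + y * I := by ring
    rw [e1, e2, smul_eq_mul, mul_one_div]
  have hmaj : Integrable fun y : ℝ ↦ (1 + ‖y‖) ^ (-r) :=
    integrable_one_add_norm (by simp; linarith)
  set J : ℝ := ∫ y : ℝ, (1 + ‖y‖) ^ (-r) with hJ
  have hJ0 : 0 ≤ J := integral_nonneg fun y ↦ Real.rpow_nonneg (by positivity) _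
  have hGcont : ∀ x : ℝ, a < x → Continuous fun y : ℝ ↦ G (x + y * I) := by
    intro x hx
    refine hG.continuousOn.comp_continuous (by fun_prop) fun y ↦ ?_
    simpa using hx
  have hGint : ∀ x : ℝ, x ∈ Icc σ' 2 → Integrable fun y : ℝ ↦ G (x + y * I) := by
    intro x hx
    refine Integrable.mono' (hmaj.const_mul C') (hGcont x (hσ'.trans_le hx.1)).aestronglyMeasurable ?_
    filter_upwards with y
    simpa [Real.norm_eq_abs] using hGb' x y hx
  have hvert : VerticalIntegrable (mellin f) 1 := by
    have : (fun y : ℝ ↦ mellin f (1 + y * I)) = fun y : ℝ ↦ G (2 + y * I) :=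
      funext fun y ↦ (hmellin y).2
    rw [VerticalIntegrable, show ((1 : ℝ) : ℂ) = 1 from ofReal_one, this]
    exact hGint 2 ⟨by linarith, le_rfl⟩
  refine IsBigO.of_bound (C' * J / (2 * Real.pi) + ‖κ‖) ?_
  filter_upwards [Ioo_mem_nhdsGT (zero_lt_one' ℝ)] with x hx
  have hx0 : (0 : ℝ) < x := hx.1
  have hx1 : x < 1 := hx.2
  have hxC : (x : ℂ) ≠ 0 := ofReal_ne_zero.2 hx0.ne'
  have hψcont : ContinuousAt ψ x := by
    have h : ψ =ᶠ[𝓝 x] fun t : ℝ ↦ 1 - (t : ℂ) := by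
      filter_upwards [Ioo_mem_nhds hx0 hx1] with t ht
      exact hψmem t ⟨ht.1, ht.2.le⟩
    exact (continuousAt_congr h).2 (by fun_prop)
  have hcont : ContinuousAt f x :=
    (hφc.continuousAt (Ioi_mem_nhds hx0)).sub (hψcont.const_smul κ)
  have hinv := mellinInv_mellin_eq 1 f hx0 (by simpa using (hmellin 0).1) hvert hcont
  set g : ℂ → ℂ := fun s ↦ (x : ℂ) ^ (1 - s) * G s with hg
  have hinv' : f x = (1 / (2 * Real.pi) : ℝ) • ∫ y : ℝ, g (2 + y * I) := by
    rw [← hinv, mellinInv]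
    congr 1
    refine integral_congr_ae (Eventually.of_forall fun y ↦ ?_)
    have e : -(1 + (y : ℂ) * I) = 1 - (2 + (y : ℂ) * I) := by ring
    simp only [hg, ofReal_one, (hmellin y).2, smul_eq_mul, e]
  have hgd : DifferentiableOn ℂ g (re ⁻¹' Icc σ' 2) := by
    intro s hs
    have hs' : a < s.re := hσ'.trans_le hs.1
    refine DifferentiableAt.differentiableWithinAt ?_
    refine DifferentiableAt.mul ?_ (hG.differentiableAt (IsOpen.mem_nhds ?_ hs'))
    · exact DifferentiableAt.const_cpow (by fun_prop) (Or.inl hxC)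
    · exact isOpen_lt continuous_const continuous_re
  have hxpow : ∀ u : ℝ, u ∈ Icc σ' 2 → ∀ y : ℝ,
      ‖(x : ℂ) ^ (1 - ((u : ℂ) + y * I))‖ = x ^ (1 - u) := by
    intro u hu y
    rw [norm_cpow_eq_rpow_re_of_pos hx0]
    simp
  have hgb : ∀ u y : ℝ, u ∈ Icc σ' 2 → ‖g (u + y * I)‖ ≤ (x⁻¹ * C') * (1 + |y|) ^ (-r) := by
    intro u y hu
    rw [hg, norm_mul, hxpow u hu y, mul_assoc]
    refine mul_le_mul ?_ (hGb' u y hu) (norm_nonneg _) (inv_pos.2 hx0).le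
    rw [← Real.rpow_neg_one]
    exact Real.rpow_le_rpow_of_exponent_ge hx0 hx1.le (by linarith [hu.2])
  have hshift : ∫ y : ℝ, g (σ' + y * I) = ∫ y : ℝ, g (2 + y * I) := by
    simpa only [ofReal_ofNat] using
      integral_vertical_eq_of_norm_le_rpow (by linarith) hr hgd hgb
  have hbound : ‖∫ y : ℝ, g (σ' + y * I)‖ ≤ C' * x ^ (1 - σ') * J := by
    have hle : ∀ y : ℝ, ‖g (σ' + y * I)‖ ≤ C' * x ^ (1 - σ') * (1 + ‖y‖) ^ (-r) := by
      intro y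
      rw [hg, norm_mul, hxpow σ' ⟨le_rfl, by linarith⟩ y, Real.norm_eq_abs]
      have := hGb' σ' y ⟨le_rfl, by linarith⟩
      calc x ^ (1 - σ') * ‖G (σ' + y * I)‖ ≤ x ^ (1 - σ') * (C' * (1 + |y|) ^ (-r)) :=
            mul_le_mul_of_nonneg_left this (Real.rpow_nonneg hx0.le _)
        _ = C' * x ^ (1 - σ') * (1 + |y|) ^ (-r) := by ring
    calc ‖∫ y : ℝ, g (σ' + y * I)‖ ≤ ∫ y : ℝ, C' * x ^ (1 - σ') * (1 + ‖y‖) ^ (-r) :=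
          norm_integral_le_of_norm_le (hmaj.const_mul _) (Eventually.of_forall hle)
      _ = C' * x ^ (1 - σ') * J := by rw [MeasureTheory.integral_const_mul]
  have hfx : ‖f x‖ ≤ C' * J / (2 * Real.pi) * x ^ (1 - σ') := by
    rw [hinv', ← hshift, norm_smul, Real.norm_eq_abs, abs_of_pos (by positivity)]
    calc 1 / (2 * Real.pi) * ‖∫ y : ℝ, g (σ' + y * I)‖
        ≤ 1 / (2 * Real.pi) * (C' * x ^ (1 - σ') * J) :=
          mul_le_mul_of_nonneg_left hbound (by positivity)
      _ = C' * J / (2 * Real.pi) * x ^ (1 - σ') := by field_simp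
  have hφx : φ x - κ = f x - κ * x := by
    simp only [hf, hψmem x ⟨hx0, hx1.le⟩, smul_eq_mul]
    ring
  have hxle : x ≤ x ^ (1 - σ') := by
    conv_lhs => rw [← Real.rpow_one x]
    exact Real.rpow_le_rpow_of_exponent_ge hx0 hx1.le (by linarith)
  rw [hφx, Real.norm_of_nonneg (Real.rpow_nonneg hx0.le _)]
  calc ‖f x - κ * x‖ ≤ ‖f x‖ + ‖κ * (x : ℂ)‖ := norm_sub_le _ _
    _ ≤ C' * J / (2 * Real.pi) * x ^ (1 - σ') + ‖κ‖ * x := by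
        rw [norm_mul, Complex.norm_of_nonneg hx0.le]
        exact add_le_add hfx le_rfl
    _ ≤ C' * J / (2 * Real.pi) * x ^ (1 - σ') + ‖κ‖ * x ^ (1 - σ') :=
        add_le_add le_rfl (mul_le_mul_of_nonneg_left hxle (norm_nonneg _))
    _ = (C' * J / (2 * Real.pi) + ‖κ‖) * x ^ (1 - σ') := by ring

/-! ### §2. Growth of `ζ` and `1/ζ` under RH -/

/-- `‖ζ(x + iy)‖ = ‖ζ(x − iy)‖`. [cite: Titchmarsh1986, §2.1 (ζ(s̄) = conj ζ(s))] -/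
theorem norm_riemannZeta_conj_symm (x y : ℝ) :
    ‖riemannZeta (x + (-y : ℝ) * I)‖ = ‖riemannZeta (x + y * I)‖ := by
  have e : (x : ℂ) + ((-y : ℝ) : ℂ) * I = (starRingEnd ℂ) ((x : ℂ) + y * I) := by
    apply Complex.ext <;> simp
  rw [e, riemannZeta_conj, Complex.norm_conj]

/-- `‖ζ(x+iy)‖ ≤ 9 |y|^{1/2}` for `1/2 ≤ x ≤ 2`, `|y| ≥ 2` (tree, from (4.11.2)), two-sided in `y`.
[cite: Titchmarsh1986, eq. (4.11.2)] -/
theorem norm_riemannZeta_le_sqrt_abs {x y : ℝ} (hx : 1 / 2 ≤ x) (hx2 : x ≤ 2) (hy : 2 ≤ |y|) :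
    ‖riemannZeta (x + y * I)‖ ≤ 9 * |y| ^ (1 / 2 : ℝ) := by
  rcases le_or_gt 0 y with h | h
  · rw [abs_of_nonneg h] at hy ⊢
    rw [← Real.sqrt_eq_rpow]
    exact SelbergMollifier.norm_riemannZeta_le_sqrt hx hx2 hy
  · rw [abs_of_neg h] at hy ⊢
    rw [← norm_riemannZeta_conj_symm, ← Real.sqrt_eq_rpow]
    exact SelbergMollifier.norm_riemannZeta_le_sqrt hx hx2 hy

/-- **Growth of `ζ` under RH left of, on and right of the critical strip**: for `0 < ε ≤ 1/4` there
is `C` with `‖ζ(w)‖ ≤ C |Im w|^{1−ε}` whenever `Re w ≥ −1/2 + 2ε` and `|Im w| ≥ 2` — Littlewood's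
`ζ(s) = O(t^ε)` for `σ > 1/2` under RH, (4.11.2) near the critical line, and the functional equation
`|ζ(σ+it)| ≤ e^{1/2}(|t|/2π)^{1/2−σ}|ζ(1−σ+it)|` to the left. [cite: Titchmarsh1986, Thm 14.2 (14.2.5), eq. (4.11.2), eq. (4.12.3)] -/
theorem exists_norm_riemannZeta_le_of_RH (hRH : RiemannHypothesis) {ε : ℝ} (hε : 0 < ε)
    (hε1 : ε ≤ 1 / 4) :
    ∃ C : ℝ, 0 < C ∧ ∀ w : ℂ, -1 / 2 + 2 * ε ≤ w.re → 2 ≤ |w.im| →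
      ‖riemannZeta w‖ ≤ C * |w.im| ^ (1 - ε) := by
  obtain ⟨C₁, hC₁, h₁⟩ := LittlewoodRH.norm_riemannZeta_le_of_RH hRH (σ₀ := 3 / 4) (by norm_num)
    (ε := ε / 2) (by linarith)
  refine ⟨9 * Real.exp (1 / 2) * (C₁ + 1), by positivity, fun w hw ht ↦ ?_⟩
  set σ : ℝ := w.re with hσ
  set t : ℝ := w.im with htdef
  have hw : w = (σ : ℂ) + t * I := (re_add_im w).symm
  have ht1 : 1 ≤ |t| := by linarith
  have ht0 : 0 < |t| := by linarith
  have hE : 1 ≤ Real.exp (1 / 2) := Real.one_le_exp (by norm_num)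
  -- monotonicity of `|t|^a` in the exponent
  have hmono : ∀ a b : ℝ, a ≤ b → |t| ^ a ≤ |t| ^ b := fun a b hab ↦
    Real.rpow_le_rpow_of_exponent_le ht1 hab
  have hbig : ∀ a : ℝ, a ≤ 1 - ε → ∀ K : ℝ, 0 ≤ K → K ≤ 9 * Real.exp (1 / 2) * (C₁ + 1) →
      K * |t| ^ a ≤ 9 * Real.exp (1 / 2) * (C₁ + 1) * |t| ^ (1 - ε) := by
    intro a ha K hK0 hK
    exact mul_le_mul hK (hmono a _ ha) (Real.rpow_nonneg ht0.le _) (by positivity)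
  rcases le_or_gt (3 / 4 : ℝ) σ with h34 | h34
  · -- `σ ≥ 3/4`: Littlewood
    have h := h₁ w (by rw [← hσ]; exact h34) ht1
    refine h.trans (hbig (ε / 2) (by linarith) C₁ hC₁.le ?_)
    nlinarith
  rcases le_or_gt (1 / 2 : ℝ) σ with h12 | h12
  · -- `1/2 ≤ σ < 3/4`: (4.11.2)
    have h := norm_riemannZeta_le_sqrt_abs h12 (by linarith) ht
    rw [← hw] at h
    refine h.trans (hbig (1 / 2) (by linarith) 9 (by norm_num) ?_)
    nlinarith
  -- `σ < 1/2`: functional equation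
  have hfe := ZetaArgBacklund.norm_riemannZeta_le_fe (σ := σ) (t := t) (by linarith) h12.le ht
  rw [← hw] at hfe
  have hexp : 0 ≤ 1 / 2 - σ := by linarith
  have hchi : (|t| / (2 * π)) ^ (1 / 2 - σ) ≤ |t| ^ (1 / 2 - σ) := by
    refine Real.rpow_le_rpow (by positivity) ?_ hexp
    rw [div_le_iff₀ (by positivity)]
    nlinarith [Real.pi_gt_three]
  rcases le_or_gt (1 / 4 : ℝ) σ with h14 | h14
  · -- `1/4 ≤ σ < 1/2`: `ζ(1-σ+it)` by (4.11.2)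
    have hz : ‖riemannZeta (1 - σ + t * I)‖ ≤ 9 * |t| ^ (1 / 2 : ℝ) := by
      have := norm_riemannZeta_le_sqrt_abs (x := 1 - σ) (y := t) (by linarith) (by linarith) ht
      push_cast at this ⊢
      exact this
    calc ‖riemannZeta w‖
        ≤ Real.exp (1 / 2) * (|t| / (2 * π)) ^ (1 / 2 - σ) * ‖riemannZeta (1 - σ + t * I)‖ := hfe
      _ ≤ Real.exp (1 / 2) * |t| ^ (1 / 2 - σ) * (9 * |t| ^ (1 / 2 : ℝ)) := by gcongr
      _ = 9 * Real.exp (1 / 2) * |t| ^ (1 / 2 - σ + 1 / 2) := by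
          rw [Real.rpow_add ht0]; ring
      _ ≤ 9 * Real.exp (1 / 2) * (C₁ + 1) * |t| ^ (1 - ε) := by
          refine hbig _ (by linarith) _ (by positivity) ?_
          nlinarith
  · -- `σ < 1/4`: `ζ(1-σ+it)` by Littlewood (`1 - σ > 3/4`)
    have hz : ‖riemannZeta (1 - σ + t * I)‖ ≤ C₁ * |t| ^ (ε / 2) := by
      have := h₁ ((1 - σ : ℝ) + t * I) (by simp; linarith) (by simpa using ht1)
      push_cast at this
      simpa using this
    calc ‖riemannZeta w‖
        ≤ Real.exp (1 / 2) * (|t| / (2 * π)) ^ (1 / 2 - σ) * ‖riemannZeta (1 - σ + t * I)‖ := hfe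
      _ ≤ Real.exp (1 / 2) * |t| ^ (1 / 2 - σ) * (C₁ * |t| ^ (ε / 2)) := by gcongr
      _ = Real.exp (1 / 2) * C₁ * |t| ^ (1 / 2 - σ + ε / 2) := by
          rw [Real.rpow_add ht0]; ring
      _ ≤ 9 * Real.exp (1 / 2) * (C₁ + 1) * |t| ^ (1 - ε) := by
          refine hbig _ (by linarith) _ (by positivity) ?_
          nlinarith

/-! ### §3. Mellin transforms: decay for `C_c²` test functions; the transform of `m_y(f)` -/

/-- A continuous `f : ℝ → ℂ` vanishing off `[a, b] ⊂ (0,∞)` has an everywhere convergent Mellin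
transform … [cite: Verjovsky1994, §2 (Mellin transform of f ∈ C_c(ℝ*) is entire)] -/
theorem mellinConvergent_of_support {f : ℝ → ℂ} (hfc : Continuous f) {a b : ℝ} (ha : 0 < a)
    (hfa : ∀ t, f t ≠ 0 → a ≤ t) (hfb : ∀ t, f t ≠ 0 → t ≤ b) (s : ℂ) : MellinConvergent f s := by
  refine mellinConvergent_of_isBigO_rpow (a := s.re + 1) (b := s.re - 1)
    (hfc.locallyIntegrable.locallyIntegrableOn _) ?_ (by linarith) ?_ (by linarith)
  · refine (isBigO_zero _ _).congr' ?_ EventuallyEq.rfl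
    filter_upwards [eventually_gt_atTop b] with v hv
    by_contra h
    exact absurd (hfb v (Ne.symm h)) (not_le.mpr hv)
  · refine (isBigO_zero _ _).congr' ?_ EventuallyEq.rfl
    have : Iio a ∈ 𝓝[>] (0 : ℝ) := mem_nhdsWithin_of_mem_nhds (Iio_mem_nhds ha)
    filter_upwards [this] with v hv
    by_contra h
    exact absurd (hfa v (Ne.symm h)) (not_le.mpr hv)

/-- … and the transform is entire. [cite: Verjovsky1994, §2 (Mellin transform of f ∈ C_c(ℝ*) is entire)] -/
theorem differentiable_mellin_of_support {f : ℝ → ℂ} (hfc : Continuous f) {a b : ℝ} (ha : 0 < a)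
    (hfa : ∀ t, f t ≠ 0 → a ≤ t) (hfb : ∀ t, f t ≠ 0 → t ≤ b) : Differentiable ℂ (mellin f) := by
  intro s
  refine mellin_differentiableAt_of_isBigO_rpow (a := s.re + 1) (b := s.re - 1)
    (hfc.locallyIntegrable.locallyIntegrableOn _) ?_ (by linarith) ?_ (by linarith)
  · refine (isBigO_zero _ _).congr' ?_ EventuallyEq.rfl
    filter_upwards [eventually_gt_atTop b] with v hv
    by_contra h
    exact absurd (hfb v (Ne.symm h)) (not_le.mpr hv)
  · refine (isBigO_zero _ _).congr' ?_ EventuallyEq.rfl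
    have : Iio a ∈ 𝓝[>] (0 : ℝ) := mem_nhdsWithin_of_mem_nhds (Iio_mem_nhds ha)
    filter_upwards [this] with v hv
    by_contra h
    exact absurd (hfa v (Ne.symm h)) (not_le.mpr hv)

/-- **Integration by parts in the Mellin transform**: for `f ∈ C¹` vanishing off `[a,b] ⊂ (0,∞)`
and `w ≠ 0`, `f̃(w) = −f̃′(w+1)/w` (`f̃′` the transform of `f′`).
[cite: Verjovsky1994, §2 (decay of the Mellin transform by integration by parts)] -/
theorem mellin_eq_neg_mellin_deriv_div {f : ℝ → ℂ} (hf : ContDiff ℝ 1 f) {a b : ℝ} (ha : 0 < a)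
    (hfa : ∀ t, f t ≠ 0 → a ≤ t) (hfb : ∀ t, f t ≠ 0 → t ≤ b) {w : ℂ} (hw : w ≠ 0) :
    mellin f w = -(mellin (deriv f) (w + 1)) / w := by
  have hfc : Continuous f := hf.continuous
  have hf'c : Continuous (deriv f) := hf.continuous_deriv le_rfl
  have hfd : ∀ x, HasDerivAt f (deriv f x) x := fun x ↦
    ((hf.differentiable one_ne_zero) x).hasDerivAt
  -- `f' = 0` off `[a, b]` as well (f is constant there)
  have hfzero : ∀ t, t ∉ Icc a b → f t = 0 := fun t ht ↦ by
    by_contra h; exact ht ⟨hfa t h, hfb t h⟩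
  have hf'zero : ∀ t, t ∉ Icc a b → deriv f t = 0 := by
    intro t ht
    have hopen : IsOpen (Icc a b)ᶜ := isClosed_Icc.isOpen_compl
    have hev : f =ᶠ[𝓝 t] fun _ ↦ 0 := by
      filter_upwards [hopen.mem_nhds ht] with u hu
      exact hfzero u hu
    rw [hev.deriv_eq, deriv_const]
  have hf'a : ∀ t, deriv f t ≠ 0 → a ≤ t := fun t h ↦ by
    by_contra h'; exact h (hf'zero t fun hm ↦ h' hm.1)
  have hf'b : ∀ t, deriv f t ≠ 0 → t ≤ b := fun t h ↦ by
    by_contra h'; exact h (hf'zero t fun hm ↦ h' hm.2)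
  -- parts on `(0, ∞)` with `u = t^w / w`, `v = f`
  set u : ℝ → ℂ := fun t ↦ (t : ℂ) ^ w / w with hu
  have hud : ∀ t ∈ Ioi (0 : ℝ), HasDerivAt u ((t : ℂ) ^ (w - 1)) t := by
    intro t ht
    have h := hasDerivAt_ofReal_cpow_const' (ne_of_gt ht) (r := w - 1)
      (by intro h; apply hw; linear_combination h)
    simp only [sub_add_cancel] at h
    exact h
  have hconv1 : MellinConvergent (deriv f) (w + 1) :=
    mellinConvergent_of_support hf'c ha hf'a hf'b _
  have hconv0 : MellinConvergent f w := mellinConvergent_of_support hfc ha hfa hfb _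
  have huv' : IntegrableOn (u * fun t ↦ deriv f t) (Ioi 0) := by
    have h := hconv1.div_const w
    refine (IntegrableOn.congr_fun h (fun t (ht : 0 < t) ↦ ?_) measurableSet_Ioi)
    simp only [hu, Pi.mul_apply, smul_eq_mul, add_sub_cancel_right]
    ring
  have hu'v : IntegrableOn ((fun t : ℝ ↦ (t : ℂ) ^ (w - 1)) * f) (Ioi 0) := by
    refine (IntegrableOn.congr_fun hconv0 (fun t _ ↦ ?_) measurableSet_Ioi)
    simp [smul_eq_mul]
  have h_zero : Tendsto (u * f) (𝓝[>] 0) (𝓝 0) := by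
    have : (u * f) =ᶠ[𝓝[>] 0] fun _ ↦ 0 := by
      have hmem : Iio a ∈ 𝓝[>] (0 : ℝ) := mem_nhdsWithin_of_mem_nhds (Iio_mem_nhds ha)
      filter_upwards [hmem] with t ht
      have : f t = 0 := by by_contra h; exact absurd (hfa t h) (not_le.mpr ht)
      simp [this]
    exact (tendsto_congr' this).2 tendsto_const_nhds
  have h_infty : Tendsto (u * f) atTop (𝓝 0) := by
    have : (u * f) =ᶠ[atTop] fun _ ↦ 0 := by
      filter_upwards [eventually_gt_atTop b] with t ht
      have : f t = 0 := by by_contra h; exact absurd (hfb t h) (not_le.mpr ht)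
      simp [this]
    exact (tendsto_congr' this).2 tendsto_const_nhds
  have hparts := integral_Ioi_mul_deriv_eq_deriv_mul hud (fun t _ ↦ hfd t) huv' hu'v h_zero h_infty
  -- read off
  have hL : ∫ t in Ioi (0 : ℝ), u t * deriv f t = mellin (deriv f) (w + 1) / w := by
    rw [mellin, ← integral_div]
    refine setIntegral_congr_fun measurableSet_Ioi fun t _ ↦ ?_
    simp only [hu, smul_eq_mul, add_sub_cancel_right]
    ring
  have hR : ∫ t in Ioi (0 : ℝ), (t : ℂ) ^ (w - 1) * f t = mellin f w := by
    rw [mellin]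
    refine setIntegral_congr_fun measurableSet_Ioi fun t _ ↦ ?_
    simp [smul_eq_mul]
  rw [hL, hR] at hparts
  have : mellin (deriv f) (w + 1) / w = -mellin f w := by rw [hparts]; ring
  rw [← neg_neg (mellin f w), ← this, neg_div]

/-- **Decay of the Mellin transform of a `C_c²(ℝ₊ˣ)` function**: `f̃(w) = f̃″(w+2)/(w(w+1))`, so on
every vertical strip `w₁ ≤ Re w ≤ w₂` there is `M` with `‖f̃(w)‖ ≤ M / |Im w|²` for `Im w ≠ 0`.
[cite: Verjovsky1994, §2 (f̂(s) = O(|s|^{-r}) for f ∈ C_c^r)] -/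
theorem exists_norm_mellin_le_of_contDiff_two {f : ℝ → ℂ} (hf : ContDiff ℝ 2 f) {a b : ℝ}
    (ha : 0 < a) (hfa : ∀ t, f t ≠ 0 → a ≤ t) (hfb : ∀ t, f t ≠ 0 → t ≤ b) (w₁ w₂ : ℝ) :
    ∃ M : ℝ, 0 ≤ M ∧ ∀ w : ℂ, w₁ ≤ w.re → w.re ≤ w₂ → w.im ≠ 0 →
      ‖mellin f w‖ ≤ M / |w.im| ^ 2 := by
  have hf1 : ContDiff ℝ 1 f := hf.of_le (by norm_num)
  have hf'1 : ContDiff ℝ 1 (deriv f) := by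
    have := hf.iterate_deriv' 1 1
    simpa using this
  have hfc : Continuous f := hf.continuous
  -- supports of `f'`, `f''`
  have hfzero : ∀ t, t ∉ Icc a b → f t = 0 := fun t ht ↦ by
    by_contra h; exact ht ⟨hfa t h, hfb t h⟩
  have hsupp_deriv : ∀ g : ℝ → ℂ, (∀ t, t ∉ Icc a b → g t = 0) →
      ∀ t, t ∉ Icc a b → deriv g t = 0 := by
    intro g hg t ht
    have hev : g =ᶠ[𝓝 t] fun _ ↦ 0 := by
      filter_upwards [isClosed_Icc.isOpen_compl.mem_nhds ht] with u hu
      exact hg u hu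
    rw [hev.deriv_eq, deriv_const]
  have hf'zero := hsupp_deriv f hfzero
  have hf''zero := hsupp_deriv (deriv f) hf'zero
  have hf'a : ∀ t, deriv f t ≠ 0 → a ≤ t := fun t h ↦ by
    by_contra h'; exact h (hf'zero t fun hm ↦ h' hm.1)
  have hf'b : ∀ t, deriv f t ≠ 0 → t ≤ b := fun t h ↦ by
    by_contra h'; exact h (hf'zero t fun hm ↦ h' hm.2)
  have hf''a : ∀ t, deriv (deriv f) t ≠ 0 → a ≤ t := fun t h ↦ by
    by_contra h'; exact h (hf''zero t fun hm ↦ h' hm.1)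
  have hf''b : ∀ t, deriv (deriv f) t ≠ 0 → t ≤ b := fun t h ↦ by
    by_contra h'; exact h (hf''zero t fun hm ↦ h' hm.2)
  have hf''c : Continuous (deriv (deriv f)) := hf'1.continuous_deriv le_rfl
  have hf''cs : HasCompactSupport (deriv (deriv f)) :=
    HasCompactSupport.intro isCompact_Icc fun t ht ↦ hf''zero t ht
  have hI₂i : Integrable fun t ↦ ‖deriv (deriv f) t‖ :=
    (hf''c.integrable_of_hasCompactSupport hf''cs).norm
  set I₂ : ℝ := ∫ t in Ioi (0 : ℝ), ‖deriv (deriv f) t‖ with hI₂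
  have hI₂0 : 0 ≤ I₂ := integral_nonneg fun t ↦ norm_nonneg _
  set S : ℝ := max |w₁ + 1| |w₂ + 1| with hS
  set L : ℝ := max |Real.log a| |Real.log b| with hL
  set M : ℝ := Real.exp (L * S) * I₂ with hM
  refine ⟨M, by positivity, fun w hw1 hw2 hwim ↦ ?_⟩
  have hw0 : w ≠ 0 := fun h ↦ hwim (by rw [h]; simp)
  have hw1' : w + 1 ≠ 0 := fun h ↦ hwim (by
    have := congrArg Complex.im h; simpa using this)
  rw [mellin_eq_neg_mellin_deriv_div hf1 ha hfa hfb hw0,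
    mellin_eq_neg_mellin_deriv_div hf'1 ha hf'a hf'b hw1']
  -- the bound for `f̃''(w + 2)`
  have hM2 : ‖mellin (deriv (deriv f)) (w + 1 + 1)‖ ≤ M := by
    rw [mellin]
    have hmaj : Integrable (fun t ↦ Real.exp (L * S) * ‖deriv (deriv f) t‖)
        (volume.restrict (Ioi 0)) := (hI₂i.const_mul _).integrableOn
    refine (norm_integral_le_of_norm_le hmaj ?_).trans (le_of_eq ?_)
    · refine (ae_restrict_iff' measurableSet_Ioi).2 (ae_of_all _ fun t (ht : 0 < t) ↦ ?_)
      rw [norm_smul, norm_cpow_eq_rpow_re_of_pos ht]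
      by_cases hft : deriv (deriv f) t = 0
      · simp [hft]
      · have htab : t ∈ Icc a b := ⟨hf''a t hft, hf''b t hft⟩
        have hσ : (w + 1 + 1 - 1).re = w.re + 1 := by simp
        rw [hσ, Real.rpow_def_of_pos ht]
        refine mul_le_mul_of_nonneg_right (Real.exp_le_exp.2 ?_) (norm_nonneg _)
        have hlog : |Real.log t| ≤ L := by
          rw [hL]
          exact abs_le_max_abs_abs (Real.log_le_log ha htab.1)
            (Real.log_le_log ht htab.2)
        have hσS : |w.re + 1| ≤ S := by
          rw [hS]
          exact abs_le_max_abs_abs (by linarith) (by linarith)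
        calc Real.log t * (w.re + 1) ≤ |Real.log t * (w.re + 1)| := le_abs_self _
          _ = |Real.log t| * |w.re + 1| := abs_mul _ _
          _ ≤ L * S := mul_le_mul hlog hσS (abs_nonneg _) ((abs_nonneg _).trans hlog)
    · rw [integral_const_mul]
  -- `‖w‖, ‖w + 1‖ ≥ |Im w|`
  have him1 : |w.im| ≤ ‖w‖ := Complex.abs_im_le_norm w
  have him2 : |w.im| ≤ ‖w + 1‖ := by
    have := Complex.abs_im_le_norm (w + 1)
    simpa using this
  have hpos : 0 < |w.im| := abs_pos.2 hwim
  rw [norm_div, norm_neg, norm_div, norm_neg]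
  calc ‖mellin (deriv (deriv f)) (w + 1 + 1)‖ / ‖w + 1‖ / ‖w‖ ≤ M / |w.im| / |w.im| := by
        gcongr
    _ = M / |w.im| ^ 2 := by rw [div_div, sq]

/-- The rows of `m_y(f)` for complex `f`: `y φ(n+1) f((n+1)√y)`. [cite: Verjovsky1994, §1 eq. (1)] -/
def rowC (f : ℝ → ℂ) (n : ℕ) (y : ℝ) : ℂ :=
  ((y * ((n + 1).totient : ℕ) : ℝ) : ℂ) * f (Real.sqrt y * (n + 1))

/-- `m_y(f) = Σ_n rowC f n y`. [cite: Verjovsky1994, §1 eq. (1)] -/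
theorem verjovskyMeasure_eq_tsum_rowC (f : ℝ → ℂ) (y : ℝ) :
    verjovskyMeasure y f = ∑' n : ℕ, rowC f n y := by
  unfold verjovskyMeasure rowC
  refine tsum_congr fun n ↦ ?_
  push_cast
  ring_nf

/-- Norm of a complex row = the real row of `‖f‖`. [cite: Verjovsky1994, §2 (absolute convergence)] -/
theorem norm_rowC {f : ℝ → ℂ} (n : ℕ) {y : ℝ} (hy : 0 ≤ y) :
    ‖rowC f n y‖ = VerjovskyCriterion.row (fun v ↦ ‖f v‖) n y := by
  unfold rowC VerjovskyCriterion.row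
  rw [norm_mul, Complex.norm_real, Real.norm_of_nonneg (by positivity)]

/-- **Mellin transform of one complex row**: `∫₀^∞ y^{s−1} rowC f n y dy = φ(n+1)·2(n+1)^{−(2s+2)} f̃(2s+2)`.
[cite: Verjovsky1994, §2 (Mellin transform of m_y)] -/
theorem mellin_rowC (f : ℝ → ℂ) (n : ℕ) (s : ℂ) :
    mellin (rowC f n) s =
      ((n + 1).totient : ℂ) * (2 * ((n : ℂ) + 1) ^ (-(2 * s + 2)) * mellin f (2 * s + 2)) := by
  have hn : (0 : ℝ) < (n : ℝ) + 1 := by positivity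
  set K : ℝ → ℂ := fun t ↦ f (((n : ℝ) + 1) * t) with hK
  have h1 : mellin (rowC f n) s =
      mellin (fun y ↦ ((n + 1).totient : ℂ) • ((y : ℂ) ^ (1 : ℂ) • K (y ^ (1 / 2 : ℝ)))) s := by
    unfold mellin
    refine setIntegral_congr_fun measurableSet_Ioi fun y hy ↦ ?_
    simp only [rowC, hK, smul_eq_mul, cpow_one, ← Real.sqrt_eq_rpow]
    push_cast
    ring_nf
  rw [h1, mellin_const_smul, mellin_cpow_smul, mellin_comp_rpow]
  have h2 : mellin K ((s + 1) / ((1 / 2 : ℝ) : ℂ)) =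
      ((((n : ℝ) + 1 : ℝ)) : ℂ) ^ (-((s + 1) / ((1 / 2 : ℝ) : ℂ))) •
        mellin f ((s + 1) / ((1 / 2 : ℝ) : ℂ)) :=
    mellin_comp_mul_left f _ hn
  rw [h2]
  have e : (s + 1) / ((1 / 2 : ℝ) : ℂ) = 2 * s + 2 := by push_cast; ring
  rw [e, show |(1 / 2 : ℝ)|⁻¹ = (2 : ℝ) by norm_num]
  simp only [smul_eq_mul, Complex.real_smul]
  push_cast
  ring

/-- **Mellin transform of `m_y(f)` for complex `f ∈ C_c(ℝ₊ˣ)`**, `re s > 0`: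
`∫₀^∞ m_y(f) y^{s−1} dy = 2 f̃(2s+2) L(φ, 2s+2)`. [cite: Verjovsky1994, §2 (Mellin transform of m_y = 2 f̃(2s+2) Σ φ(n) n^{−2s−2})] -/
theorem mellin_verjovskyMeasure_complex {f : ℝ → ℂ} (hfc : Continuous f) {a b : ℝ} (ha : 0 < a)
    (hfa : ∀ t, f t ≠ 0 → a ≤ t) (hfb : ∀ t, f t ≠ 0 → t ≤ b) {s : ℂ} (hs : 0 < s.re) :
    mellin (fun y ↦ verjovskyMeasure y f) s =
      2 * mellin f (2 * s + 2) * LSeries (fun n ↦ (n.totient : ℂ)) (2 * s + 2) := by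
  set σ : ℝ := s.re with hσ
  set w : ℂ := 2 * s + 2 with hw
  have hwre : 2 < w.re := by simp [hw]; linarith
  set F : ℕ → ℝ → ℂ := fun n y ↦ (y : ℂ) ^ (s - 1) • rowC f n y with hF
  have hna : ∀ t, ‖f t‖ ≠ 0 → a ≤ t := fun t h ↦ hfa t (fun h' ↦ h (by simp [h']))
  have hnb : ∀ t, ‖f t‖ ≠ 0 → t ≤ b := fun t h ↦ hfb t (fun h' ↦ h (by simp [h']))
  -- support of the rows
  have hrow_ne : ∀ n y, rowC f n y ≠ 0 → VerjovskyCriterion.row (fun v ↦ ‖f v‖) n y ≠ 0 := by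
    intro n y h
    unfold rowC at h
    unfold VerjovskyCriterion.row
    have h1 : ((y * ((n + 1).totient : ℕ) : ℝ) : ℂ) ≠ 0 := left_ne_zero_of_mul h
    have h2 : f (Real.sqrt y * (n + 1)) ≠ 0 := right_ne_zero_of_mul h
    have h1' : (y * ((n + 1).totient : ℕ) : ℝ) ≠ 0 := by exact_mod_cast h1
    have h3 : ‖f (Real.sqrt y * (n + 1))‖ ≠ 0 := by simpa using h2
    have : y * ((n + 1).totient : ℝ) * ‖f (Real.sqrt y * (n + 1))‖ ≠ 0 := mul_ne_zero h1' h3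
    simpa using this
  have hF_int : ∀ n, Integrable (F n) (volume.restrict (Ioi 0)) := fun n ↦ by
    have hc : Continuous (rowC f n) := by
      unfold rowC
      exact (continuous_ofReal.comp (continuous_id.mul continuous_const)).mul
        (hfc.comp (Real.continuous_sqrt.mul continuous_const))
    have h := mellinConvergent_of_support hc (a := (a / (n + 1)) ^ 2)
      (b := (max a b / (n + 1)) ^ 2) (by positivity)
      (fun y hy ↦ VerjovskyCriterion.sq_le_of_row_ne_zero ha hna (hrow_ne n y hy))
      (fun y hy ↦ VerjovskyCriterion.le_sq_of_row_ne_zero ha hna hnb (hrow_ne n y hy)) s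
    exact h
  -- norms of the rows: reduce to the real rows of `‖f‖`
  set J : ℝ := ∫ v in Ioi (0 : ℝ), v ^ (2 * σ + 2 - 1) * |‖f v‖| with hJ
  have hJ0 : 0 ≤ J := setIntegral_nonneg measurableSet_Ioi fun v hv ↦
    mul_nonneg (Real.rpow_nonneg (le_of_lt hv) _) (abs_nonneg _)
  have hnorm : ∀ n, ∫ y in Ioi (0 : ℝ), ‖F n y‖ =
      ((n + 1).totient : ℝ) * (2 * ((n : ℝ) + 1) ^ (-(2 * σ + 2)) * J) := by
    intro n
    rw [← VerjovskyCriterion.integral_norm_row (fun v ↦ ‖f v‖) n s]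
    refine setIntegral_congr_fun measurableSet_Ioi fun y (hy : 0 < y) ↦ ?_
    simp only [hF, norm_smul]
    rw [norm_rowC n hy.le, Complex.norm_real, Real.norm_of_nonneg]
    unfold VerjovskyCriterion.row
    positivity
  have hF_sum : Summable fun n ↦ ∫ y in Ioi (0 : ℝ), ‖F n y‖ := by
    simp_rw [hnorm]
    have hp : Summable fun n : ℕ ↦ ((n : ℝ) + 1) ^ (-(2 * σ + 1)) := by
      have h := (summable_nat_add_iff 1).2 (Real.summable_nat_rpow.2
        (show -(2 * σ + 1) < -1 by linarith))
      refine h.congr fun n ↦ ?_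
      push_cast; ring_nf
    refine Summable.of_nonneg_of_le (fun n ↦ ?_) (fun n ↦ ?_) (hp.mul_left (2 * J))
    · have : 0 ≤ ((n : ℝ) + 1) ^ (-(2 * σ + 2)) := Real.rpow_nonneg (by positivity) _
      positivity
    · have hn : (0 : ℝ) < (n : ℝ) + 1 := by positivity
      have hφ : ((n + 1).totient : ℝ) ≤ (n : ℝ) + 1 := by exact_mod_cast Nat.totient_le (n + 1)
      have hpow : ((n : ℝ) + 1) * ((n : ℝ) + 1) ^ (-(2 * σ + 2)) = ((n : ℝ) + 1) ^ (-(2 * σ + 1)) := by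
        rw [show -(2 * σ + 1) = -(2 * σ + 2) + 1 by ring, Real.rpow_add_one hn.ne']
        ring
      have h0 : 0 ≤ ((n : ℝ) + 1) ^ (-(2 * σ + 2)) := Real.rpow_nonneg hn.le _
      calc ((n + 1).totient : ℝ) * (2 * ((n : ℝ) + 1) ^ (-(2 * σ + 2)) * J)
          ≤ ((n : ℝ) + 1) * (2 * ((n : ℝ) + 1) ^ (-(2 * σ + 2)) * J) := by gcongr
        _ = 2 * J * ((n : ℝ) + 1) ^ (-(2 * σ + 1)) := by rw [← hpow]; ring
  have hsum := hasSum_integral_of_summable_integral_norm hF_int hF_sum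
  have hlhs : ∫ y in Ioi (0 : ℝ), (∑' n, F n y) = mellin (fun y ↦ verjovskyMeasure y f) s := by
    unfold mellin
    refine setIntegral_congr_fun measurableSet_Ioi fun y _ ↦ ?_
    beta_reduce
    rw [verjovskyMeasure_eq_tsum_rowC, smul_eq_mul, ← tsum_mul_left]
    simp only [hF, smul_eq_mul]
  have hrow : ∀ n, ∫ y in Ioi (0 : ℝ), F n y =
      ((n + 1).totient : ℂ) * (2 * ((n : ℂ) + 1) ^ (-w) * mellin f w) :=
    fun n ↦ mellin_rowC f n s
  rw [hlhs] at hsum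
  simp_rw [hrow] at hsum
  rw [← hsum.tsum_eq]
  have habs : LSeries.abscissaOfAbsConv (fun n ↦ (n.totient : ℂ)) < w.re := by
    refine lt_of_le_of_lt
      (LSeries.abscissaOfAbsConv_le_of_le_const_mul_rpow (x := 1) ⟨1, fun n _ ↦ ?_⟩) ?_
    · simp only [Complex.norm_natCast, Real.rpow_one, one_mul]
      exact_mod_cast Nat.totient_le n
    · have : ((1 : ℝ) : EReal) + 1 = ((2 : ℝ) : EReal) := by
        rw [← EReal.coe_one, ← EReal.coe_add]; norm_num
      rw [this]
      exact EReal.coe_lt_coe_iff.mpr hwre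
  have hLs : LSeriesSummable (fun n ↦ (n.totient : ℂ)) w :=
    LSeriesSummable_of_abscissaOfAbsConv_lt_re habs
  have hL : LSeries (fun n ↦ (n.totient : ℂ)) w =
      ∑' n : ℕ, ((n + 1).totient : ℂ) * ((n : ℂ) + 1) ^ (-w) := by
    rw [LSeries, hLs.tsum_eq_zero_add]
    simp only [LSeries.term_zero, zero_add]
    refine tsum_congr fun n ↦ ?_
    rw [LSeries.term_of_ne_zero (Nat.succ_ne_zero n), cpow_neg, div_eq_mul_inv]
    push_cast
    ring
  rw [hL, ← tsum_mul_left]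
  refine tsum_congr fun n ↦ ?_
  ring

/-! ### §4. The necessity half of Theorem B 1) -/

/-- `m₀(f) = f̃(2)/ζ(2)` (`m₀(f) = (6/π²)∫₀^∞ u f(u) du`, `ζ(2) = π²/6`).
[cite: Verjovsky1994, §1 (m₀(f) = ζ(2)⁻¹ ∫ u f(u) du)] -/
theorem verjovskyMean_eq_mellin_two (f : ℝ → ℂ) :
    verjovskyMean f = mellin f 2 / riemannZeta 2 := by
  rw [verjovskyMean, mellin, riemannZeta_two]
  have hπ : (Real.pi : ℂ) ≠ 0 := by exact_mod_cast Real.pi_ne_zero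
  have e : ∀ u ∈ Ioi (0 : ℝ), ((6 / Real.pi ^ 2 * u : ℝ) : ℂ) * f u =
      (6 / (Real.pi : ℂ) ^ 2) * ((u : ℂ) ^ ((2 : ℂ) - 1) • f u) := by
    intro u _
    rw [show (2 : ℂ) - 1 = 1 by norm_num, cpow_one, smul_eq_mul]
    push_cast
    ring
  rw [setIntegral_congr_fun measurableSet_Ioi e, integral_const_mul]
  field_simp

/-- `y^a = o(y^b)` at `0⁺` for `b < a`. [folklore] -/
private theorem rpow_isLittleO_rpow_nhdsGT' {a b : ℝ} (hab : b < a) :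
    (fun y : ℝ ↦ y ^ a) =o[𝓝[>] 0] fun y : ℝ ↦ y ^ b := by
  refine isLittleO_iff.2 fun c hc ↦ ?_
  have hab' : 0 < a - b := by linarith
  have hδ : 0 < c ^ (1 / (a - b)) := Real.rpow_pos_of_pos hc _
  filter_upwards [Ioo_mem_nhdsGT hδ] with y hy
  obtain ⟨hy0, hy1⟩ := hy
  rw [Real.norm_of_nonneg (Real.rpow_nonneg hy0.le _),
    Real.norm_of_nonneg (Real.rpow_nonneg hy0.le _)]
  have hsplit : y ^ a = y ^ (a - b) * y ^ b := by
    rw [← Real.rpow_add hy0]; ring_nf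
  rw [hsplit]
  have hyb : 0 ≤ y ^ b := Real.rpow_nonneg hy0.le _
  have hle : y ^ (a - b) ≤ c := by
    calc y ^ (a - b) ≤ (c ^ (1 / (a - b))) ^ (a - b) :=
          Real.rpow_le_rpow hy0.le hy1.le hab'.le
      _ = c := by
          rw [← Real.rpow_mul hc.le, one_div_mul_cancel hab'.ne', Real.rpow_one]
  exact mul_le_mul_of_nonneg_right hle hyb

/-- For `|y| ≥ 2` and `0 ≤ q ≤ 2`: `|y|^{-q} ≤ 4 (1+|y|)^{-q}`. [folklore] -/
private theorem abs_rpow_neg_le {y q : ℝ} (hy : 2 ≤ |y|) (hq0 : 0 ≤ q) (hq : q ≤ 2) :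
    |y| ^ (-q) ≤ 4 * (1 + |y|) ^ (-q) := by
  have hy0 : 0 < |y| := by linarith
  have h1 : 1 + |y| ≤ 2 * |y| := by linarith
  -- `(1+|y|)^{-q} ≥ (2|y|)^{-q} = 2^{-q} |y|^{-q} ≥ (1/4) |y|^{-q}`
  have h2 : (2 * |y|) ^ (-q) ≤ (1 + |y|) ^ (-q) := by
    rw [Real.rpow_neg (by positivity), Real.rpow_neg (by positivity)]
    exact inv_anti₀ (Real.rpow_pos_of_pos (by positivity) _)
      (Real.rpow_le_rpow (by positivity) h1 hq0)
  rw [Real.mul_rpow (by norm_num) hy0.le] at h2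
  have h3 : (1 / 4 : ℝ) ≤ (2 : ℝ) ^ (-q) := by
    rw [Real.rpow_neg (by norm_num)]
    have : (2 : ℝ) ^ q ≤ 2 ^ (2 : ℝ) := Real.rpow_le_rpow_of_exponent_le (by norm_num) hq
    have h4 : (2 : ℝ) ^ (2 : ℝ) = 4 := by norm_num
    rw [h4] at this
    rw [one_div]
    exact inv_anti₀ (by positivity) this
  have h5 : 0 ≤ |y| ^ (-q) := Real.rpow_nonneg hy0.le _
  nlinarith

/-- **Verjovsky's Theorem B 1), necessity, `O`-form for `C_c²(ℝ₊ˣ)`**: under RH, for every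
`f ∈ C_c²(ℝ₊ˣ)` and `0 < ε ≤ 1/4`, `m_y(f) − m₀(f) = O(y^{3/4−ε})` as `y → 0⁺`. Proof by Mellin
inversion (§1) of `2f̃(2s)ζ(2s−1)/ζ(2s) − m₀/((s−1)s)`, holomorphic on `re s > 1/4` under RH, with
the growth inputs of §2–§3. [cite: Verjovsky1994, Thm B 1) p. 597 (necessity; §3 pp. 603–604)] -/
theorem verjovskyRate_of_RH (hRH : RiemannHypothesis) {f : ℝ → ℂ} (hf : IsVerjovskyTest 2 f)
    {ε : ℝ} (hε : 0 < ε) (hε1 : ε ≤ 1 / 4) :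
    (fun y : ℝ ↦ verjovskyMeasure y f - verjovskyMean f) =O[𝓝[>] 0]
      fun y : ℝ ↦ y ^ (3 / 4 - ε) := by
  obtain ⟨hcd, hcs, hsupp⟩ := hf
  have hfc : Continuous f := hcd.continuous
  -- support `[a₀, b₀] ⊂ (0, ∞)`
  have h0 : (0 : ℝ) ∉ tsupport f := fun h ↦ lt_irrefl (0 : ℝ) (hsupp h)
  obtain ⟨δ, hδ, hδf⟩ := Metric.eventually_nhds_iff.1 (notMem_tsupport_iff_eventuallyEq.1 h0)
  obtain ⟨r₀, hr₀⟩ := (hcs.isCompact.isBounded).subset_closedBall (0 : ℝ)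
  set a₀ : ℝ := δ with ha₀
  set b₀ : ℝ := max r₀ 0 + 1 with hb₀
  have ha₀0 : 0 < a₀ := hδ
  have hfa : ∀ t, f t ≠ 0 → a₀ ≤ t := by
    intro t ht
    have htpos : 0 < t := hsupp (subset_tsupport f ht)
    by_contra h
    have : dist t 0 < δ := by
      rw [dist_zero_right, Real.norm_eq_abs, abs_of_pos htpos]; linarith
    exact ht (hδf this)
  have hfb : ∀ t, f t ≠ 0 → t ≤ b₀ := by
    intro t ht
    have h1 := hr₀ (subset_tsupport f ht)
    rw [Metric.mem_closedBall, dist_zero_right, Real.norm_eq_abs] at h1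
    have : t ≤ r₀ := (le_abs_self t).trans h1
    rw [hb₀]; linarith [le_max_left r₀ 0]
  have hb₀0 : 0 < b₀ := by rw [hb₀]; linarith [le_max_right r₀ 0]
  have hfR : ∀ t, b₀ + 1 ≤ t → f t = 0 := fun t ht ↦ by
    by_contra h; linarith [hfb t h]
  -- `V`, continuity, Mellin convergence on `re s = 1`
  set V : ℝ → ℂ := fun y ↦ verjovskyMeasure y f with hV
  set m₀ : ℂ := verjovskyMean f with hm₀
  have hVcont : ContinuousOn V (Ioi 0) := VerjovskyCriterion.continuousOn_verjovskyMeasure hfc hfR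
  have hVzero : ∀ y, (b₀ + 1) ^ 2 ≤ y → V y = 0 := fun y hy ↦
    VerjovskyCriterion.verjovskyMeasure_eq_zero_of_le (by linarith) hfR hy
  have hA := Verjovsky1994_thmA_holds f ⟨hcd.of_le (by norm_num), hcs, hsupp⟩
  have hVbdd : V =O[𝓝[>] 0] fun y : ℝ ↦ y ^ (-(0 : ℝ)) := by
    have h1 : (fun y : ℝ ↦ y ^ (1 / 2 : ℝ) * Real.log y) =O[𝓝[>] 0]
        fun y : ℝ ↦ y ^ (-(0 : ℝ)) := by
      refine IsBigO.of_bound 2 ?_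
      filter_upwards [Ioo_mem_nhdsGT (zero_lt_one' ℝ)] with y hy
      rw [neg_zero, Real.rpow_zero, Real.norm_eq_abs, Real.norm_eq_abs, abs_one, mul_one,
        mul_comm]
      have := Real.abs_log_mul_self_rpow_lt y (1 / 2) hy.1 hy.2.le (by norm_num)
      linarith
    have h2 : (fun _ : ℝ ↦ m₀) =O[𝓝[>] 0] fun y : ℝ ↦ y ^ (-(0 : ℝ)) := by
      refine IsBigO.of_bound ‖m₀‖ ?_
      filter_upwards with y
      simp
    have := (hA.trans h1).add h2
    simpa [hV, hm₀] using this
  have hVli : LocallyIntegrableOn V (Ioi 0) := hVcont.locallyIntegrableOn measurableSet_Ioi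
  have hVconv : ∀ y : ℝ, MellinConvergent V (1 + y * I) := by
    intro y
    refine mellinConvergent_of_isBigO_rpow (a := 2) (b := 0) hVli ?_ (by simp) hVbdd (by simp)
    refine (isBigO_zero _ _).congr' ?_ EventuallyEq.rfl
    filter_upwards [eventually_ge_atTop ((b₀ + 1) ^ 2)] with t ht
    exact (hVzero t ht).symm
  -- the analytic data
  set Mf : ℂ → ℂ := mellin f with hMf
  have hMfd : Differentiable ℂ Mf := differentiable_mellin_of_support hfc ha₀0 hfa hfb
  obtain ⟨M, hM0, hM⟩ := exists_norm_mellin_le_of_contDiff_two hcd ha₀0 hfa hfb (1 / 2) 4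
  obtain ⟨Cζ, hCζ, hζb⟩ := exists_norm_riemannZeta_le_of_RH hRH hε hε1
  obtain ⟨CL, hCL, hLb⟩ := InvZetaRH.exists_norm_inv_riemannZeta_le hRH
    (σ₀ := 1 / 2 + 2 * ε) (by linarith) (ε := ε / 2) (by linarith)
  set κ : ℂ := m₀ with hκ
  set Φ : ℂ → ℂ := fun s ↦ Mf (2 * s) * zetaReg (2 * s - 1) * (2 * s - 1) / zetaReg (2 * s)
    with hΦ
  set Ψ : ℂ → ℂ := fun s ↦ Φ s - κ / s with hΨ
  set U : Set ℂ := {s : ℂ | 1 / 4 < s.re} with hU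
  have hUopen : IsOpen U := isOpen_lt continuous_const continuous_re
  -- `zetaReg (2s) ≠ 0` on `U` (RH)
  have hzR : ∀ s ∈ U, zetaReg (2 * s) ≠ 0 := by
    intro s hs
    have hs' : 1 / 4 < s.re := hs
    by_cases h1 : 2 * s = 1
    · rw [h1, zetaReg, Function.update_self]; exact one_ne_zero
    · rw [zetaReg_of_ne_one h1]
      refine mul_ne_zero (sub_ne_zero.2 h1) fun hz ↦ ?_
      have hre : (2 * s).re = 1 / 2 := by
        refine hRH (2 * s) hz ?_ h1
        rintro ⟨n, hn⟩
        have := congrArg Complex.re hn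
        simp at this
        have : (0 : ℝ) ≤ n := n.cast_nonneg
        linarith
      simp at hre
      linarith
  have hΦd : DifferentiableOn ℂ Φ U := by
    intro s hs
    apply DifferentiableAt.differentiableWithinAt
    have h1 : DifferentiableAt ℂ (fun s ↦ Mf (2 * s)) s :=
      (hMfd.comp (differentiable_id.const_mul (2 : ℂ))).differentiableAt
    have h2 : DifferentiableAt ℂ (fun s ↦ zetaReg (2 * s - 1)) s :=
      (differentiable_zetaReg.comp ((differentiable_id.const_mul (2 : ℂ)).sub_const 1)).differentiableAt
    have h3 : DifferentiableAt ℂ (fun s : ℂ ↦ 2 * s - 1) s :=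
      (differentiableAt_id.const_mul (2 : ℂ)).sub_const 1
    have h4 : DifferentiableAt ℂ (fun s ↦ zetaReg (2 * s)) s :=
      (differentiable_zetaReg.comp (differentiable_id.const_mul (2 : ℂ))).differentiableAt
    exact ((h1.mul h2).mul h3).div h4 (hzR s hs)
  have hΨd : DifferentiableOn ℂ Ψ U := by
    intro s hs
    have hs0 : s ≠ 0 := by
      intro h; have : 1 / 4 < s.re := hs; rw [h] at this; simp at this; linarith
    exact (hΦd s hs).sub
      (((differentiableAt_const κ).div differentiableAt_id hs0).differentiableWithinAt)
  have hGd : DifferentiableOn ℂ (dslope Ψ 1) U :=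
    (Complex.differentiableOn_dslope (hUopen.mem_nhds (by simp [hU]; norm_num))).2 hΨd
  -- `Ψ 1 = 0`, i.e. `Φ 1 = κ`
  have hΦ1 : Φ 1 = κ := by
    have e1 : zetaReg (2 * (1 : ℂ) - 1) = 1 := by
      rw [show (2 : ℂ) * 1 - 1 = 1 by norm_num, zetaReg, Function.update_self]
    have e2 : zetaReg (2 * (1 : ℂ)) = riemannZeta 2 := by
      rw [mul_one, zetaReg_of_ne_one (by norm_num : (2 : ℂ) ≠ 1)]; ring
    show mellin f (2 * 1) * zetaReg (2 * 1 - 1) * (2 * 1 - 1) / zetaReg (2 * 1) = verjovskyMean f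
    rw [e1, e2, verjovskyMean_eq_mellin_two]
    norm_num
  have hΨ1 : Ψ 1 = 0 := by simp only [hΨ, hΦ1, div_one, sub_self]
  -- the identity on `re s > 1`
  have hGeq : ∀ s : ℂ, 1 < s.re → dslope Ψ 1 s = mellin V (s - 1) - κ / ((s - 1) * s) := by
    intro s hs
    have hs1 : s ≠ 1 := by intro h; rw [h] at hs; simp at hs
    have hs0 : s ≠ 0 := by intro h; rw [h] at hs; simp at hs; linarith
    have h2s1 : 2 * s - 1 ≠ 1 := by
      intro h; have := congrArg Complex.re h; simp at this; linarith
    have h2s : 2 * s ≠ 1 := by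
      intro h; have := congrArg Complex.re h; simp at this; linarith
    have hζ2s : riemannZeta (2 * s) ≠ 0 :=
      riemannZeta_ne_zero_of_one_lt_re (by simp; linarith)
    have hLζ := LSeries_totient_mul_zeta (w := 2 * s) (by simp; linarith)
    have hmel : mellin V (s - 1) = 2 * Mf (2 * s) *
        LSeries (fun n ↦ (n.totient : ℂ)) (2 * s) := by
      have h := mellin_verjovskyMeasure_complex hfc ha₀0 hfa hfb (s := s - 1)
        (by simp; linarith)
      rw [show 2 * (s - 1) + 2 = 2 * s by ring] at h
      exact h
    rw [dslope_of_ne _ hs1, slope_def_field, hΨ1, sub_zero, hmel]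
    simp only [hΨ, hΦ]
    rw [zetaReg_of_ne_one h2s1, zetaReg_of_ne_one h2s, ← hLζ]
    have hsub1 : s - 1 ≠ 0 := sub_ne_zero.2 hs1
    have h2s1' : (2 : ℂ) * s - 1 ≠ 0 := by
      intro h; have := congrArg Complex.re h; simp at this; linarith
    field_simp
    ring
  -- the bound on the strip `1/4 + ε ≤ re s ≤ 2`, `|im s| ≥ 2`
  set σ' : ℝ := 1 / 4 + ε with hσ'
  have hGb : ∀ x y : ℝ, x ∈ Icc σ' 2 → 2 ≤ |y| →
      ‖dslope Ψ 1 (x + y * I)‖ ≤ (4 * (3 * M * Cζ * CL + ‖κ‖)) * (1 + |y|) ^ (-(1 + ε / 2)) := by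
    intro x y hx hy
    set s : ℂ := x + y * I with hsdef
    have hsre : s.re = x := by simp [hsdef]
    have hsim : s.im = y := by simp [hsdef]
    have hy0 : 0 < |y| := by linarith
    have hyne : y ≠ 0 := abs_pos.1 hy0
    have hs1 : s ≠ 1 := by
      intro h; have := congrArg Complex.im h; rw [hsim] at this; simp at this; exact hyne this
    have hs0 : s ≠ 0 := by
      intro h; have := congrArg Complex.im h; rw [hsim] at this; simp at this; exact hyne this
    have h2s1 : 2 * s - 1 ≠ 1 := by
      intro h; have := congrArg Complex.im h; simp [hsim] at this; exact hyne this
    have h2s : 2 * s ≠ 1 := by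
      intro h; have := congrArg Complex.im h; simp [hsim] at this; exact hyne this
    -- `G s = 2 Mf(2s) ζ(2s-1)/ζ(2s) − κ/((s-1)s)`
    have hζ2s : riemannZeta (2 * s) ≠ 0 := by
      have := hzR s (by show 1 / 4 < s.re; rw [hsre]; linarith [hx.1])
      rw [zetaReg_of_ne_one h2s] at this
      exact right_ne_zero_of_mul this
    have hGs : dslope Ψ 1 s = 2 * Mf (2 * s) * riemannZeta (2 * s - 1) * (riemannZeta (2 * s))⁻¹ -
        κ / ((s - 1) * s) := by
      rw [dslope_of_ne _ hs1, slope_def_field, hΨ1, sub_zero]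
      simp only [hΨ, hΦ]
      rw [zetaReg_of_ne_one h2s1, zetaReg_of_ne_one h2s]
      have hsub1 : s - 1 ≠ 0 := sub_ne_zero.2 hs1
      have h2s1' : (2 : ℂ) * s - 1 ≠ 0 := by
        intro h; have := congrArg Complex.im h; simp [hsim] at this; exact hyne this
      field_simp
      ring
    -- the three factors
    have hA : ‖Mf (2 * s)‖ ≤ M / (2 * |y|) ^ 2 := by
      have h := hM (2 * s) (by simp [hsre]; linarith [hx.1]) (by simp [hsre]; linarith [hx.2])
        (by simp [hsim]; exact hyne)
      have : |(2 * s).im| = 2 * |y| := by simp [hsim, abs_mul]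
      rwa [this] at h
    have hB : ‖riemannZeta (2 * s - 1)‖ ≤ Cζ * (2 * |y|) ^ (1 - ε) := by
      have h := hζb (2 * s - 1) (by simp [hsre]; linarith [hx.1]) (by simp [hsim, abs_mul]; linarith)
      have : |(2 * s - 1).im| = 2 * |y| := by simp [hsim, abs_mul]
      rwa [this] at h
    have hD : ‖(riemannZeta (2 * s))⁻¹‖ ≤ CL * (1 + 2 * |y|) ^ (ε / 2) := by
      have h := hLb (2 * s) (by simp [hsre]; linarith [hx.1])
      have : |(2 * s).im| = 2 * |y| := by simp [hsim, abs_mul]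
      rwa [this] at h
    -- simplify the powers of `|y|`
    have hB' : ‖riemannZeta (2 * s - 1)‖ ≤ 2 * Cζ * |y| ^ (1 - ε) := by
      refine hB.trans ?_
      rw [Real.mul_rpow (by norm_num) hy0.le]
      have : (2 : ℝ) ^ (1 - ε) ≤ 2 := by
        conv_rhs => rw [← Real.rpow_one 2]
        exact Real.rpow_le_rpow_of_exponent_le (by norm_num) (by linarith)
      have h0 : 0 ≤ |y| ^ (1 - ε) := Real.rpow_nonneg hy0.le _
      have h5 : (2 : ℝ) ^ (1 - ε) * |y| ^ (1 - ε) ≤ 2 * |y| ^ (1 - ε) :=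
        mul_le_mul_of_nonneg_right this h0
      calc Cζ * ((2 : ℝ) ^ (1 - ε) * |y| ^ (1 - ε)) ≤ Cζ * (2 * |y| ^ (1 - ε)) :=
            mul_le_mul_of_nonneg_left h5 hCζ.le
        _ = 2 * Cζ * |y| ^ (1 - ε) := by ring
    have hD' : ‖(riemannZeta (2 * s))⁻¹‖ ≤ 3 * CL * |y| ^ (ε / 2) := by
      refine hD.trans ?_
      have h1 : (1 + 2 * |y|) ^ (ε / 2) ≤ (3 * |y|) ^ (ε / 2) :=
        Real.rpow_le_rpow (by positivity) (by linarith) (by linarith)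
      rw [Real.mul_rpow (by norm_num) hy0.le] at h1
      have h3 : (3 : ℝ) ^ (ε / 2) ≤ 3 := by
        conv_rhs => rw [← Real.rpow_one 3]
        exact Real.rpow_le_rpow_of_exponent_le (by norm_num) (by linarith)
      have h0 : 0 ≤ |y| ^ (ε / 2) := Real.rpow_nonneg hy0.le _
      calc CL * (1 + 2 * |y|) ^ (ε / 2) ≤ CL * ((3 : ℝ) ^ (ε / 2) * |y| ^ (ε / 2)) := by gcongr
        _ ≤ CL * (3 * |y| ^ (ε / 2)) := by gcongr
        _ = 3 * CL * |y| ^ (ε / 2) := by ring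
    have hA' : ‖Mf (2 * s)‖ ≤ M / 4 * |y| ^ (-(2 : ℝ)) := by
      refine hA.trans (le_of_eq ?_)
      rw [Real.rpow_neg hy0.le, show (2 : ℝ) = (2 : ℕ) by norm_num, Real.rpow_natCast]
      field_simp
      ring
    have hmain : ‖2 * Mf (2 * s) * riemannZeta (2 * s - 1) * (riemannZeta (2 * s))⁻¹‖ ≤
        3 * M * Cζ * CL * |y| ^ (-(1 + ε / 2)) := by
      rw [norm_mul, norm_mul, norm_mul, Complex.norm_ofNat]
      have h0A : 0 ≤ M / 4 * |y| ^ (-(2 : ℝ)) := by positivity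
      have h0B : 0 ≤ 2 * Cζ * |y| ^ (1 - ε) := by positivity
      calc 2 * ‖Mf (2 * s)‖ * ‖riemannZeta (2 * s - 1)‖ * ‖(riemannZeta (2 * s))⁻¹‖
          ≤ 2 * (M / 4 * |y| ^ (-(2 : ℝ))) * (2 * Cζ * |y| ^ (1 - ε)) * (3 * CL * |y| ^ (ε / 2)) := by
            gcongr
        _ = 3 * M * Cζ * CL * (|y| ^ (-(2 : ℝ)) * |y| ^ (1 - ε) * |y| ^ (ε / 2)) := by ring
        _ = 3 * M * Cζ * CL * |y| ^ (-(1 + ε / 2)) := by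
            rw [← Real.rpow_add hy0, ← Real.rpow_add hy0]; ring_nf
    have hκs : ‖κ / ((s - 1) * s)‖ ≤ ‖κ‖ * |y| ^ (-(1 + ε / 2)) := by
      rw [norm_div, norm_mul]
      have h1 : |y| ≤ ‖s - 1‖ := by
        have := Complex.abs_im_le_norm (s - 1); simpa [hsim] using this
      have h2 : |y| ≤ ‖s‖ := by
        have := Complex.abs_im_le_norm s; simpa [hsim] using this
      have h3 : ‖κ‖ / (‖s - 1‖ * ‖s‖) ≤ ‖κ‖ / (|y| * |y|) := by
        gcongr
      refine h3.trans ?_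
      have h4 : |y| * |y| = |y| ^ (2 : ℝ) := by
        rw [show (2 : ℝ) = (2 : ℕ) by norm_num, Real.rpow_natCast, sq]
      rw [h4, div_eq_mul_inv, ← Real.rpow_neg hy0.le]
      exact mul_le_mul_of_nonneg_left
        (Real.rpow_le_rpow_of_exponent_le (by linarith) (by linarith)) (norm_nonneg _)
    have hq := abs_rpow_neg_le (y := y) (q := 1 + ε / 2) hy (by linarith) (by linarith)
    rw [hGs]
    calc ‖2 * Mf (2 * s) * riemannZeta (2 * s - 1) * (riemannZeta (2 * s))⁻¹ - κ / ((s - 1) * s)‖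
        ≤ ‖2 * Mf (2 * s) * riemannZeta (2 * s - 1) * (riemannZeta (2 * s))⁻¹‖ +
          ‖κ / ((s - 1) * s)‖ := norm_sub_le _ _
      _ ≤ 3 * M * Cζ * CL * |y| ^ (-(1 + ε / 2)) + ‖κ‖ * |y| ^ (-(1 + ε / 2)) :=
          add_le_add hmain hκs
      _ = (3 * M * Cζ * CL + ‖κ‖) * |y| ^ (-(1 + ε / 2)) := by ring
      _ ≤ (3 * M * Cζ * CL + ‖κ‖) * (4 * (1 + |y|) ^ (-(1 + ε / 2))) := by
          gcongr
      _ = (4 * (3 * M * Cζ * CL + ‖κ‖)) * (1 + |y|) ^ (-(1 + ε / 2)) := by ring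
  -- Mellin inversion
  have hmain := isBigO_nhdsGT_zero_of_mellin_continuation_rpow (a := 1 / 4) (σ' := σ')
    (T₀ := 2) (κ := κ) hVcont hVconv (by rw [hσ']; linarith) (by rw [hσ']; linarith)
    (by rw [hσ']; linarith) hGd hGeq (r := 1 + ε / 2) (by linarith) hGb
  have e : 1 - σ' = 3 / 4 - ε := by rw [hσ']; ring
  rw [e] at hmain
  simpa [hV, hκ, hm₀] using hmain

end VerjovskyNecessity

open VerjovskyNecessity in
/-- **Verjovsky 1994, Theorem B 1) — necessity half** (PROVED): under RH, for every
`f ∈ C_c²(ℝ₊ˣ)` and every `ε > 0`, `m_y(f) − m₀(f) = o(y^{3/4−ε})` as `y → 0⁺`.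
[cite: Verjovsky1994, Thm B 1) p. 597 (necessity)] -/
theorem Verjovsky1994_thmB1.mp_holds (hRH : RiemannHypothesis) :
    ∀ f : ℝ → ℂ, IsVerjovskyTest 2 f → ∀ ε : ℝ, 0 < ε →
      (fun y : ℝ ↦ verjovskyMeasure y f - verjovskyMean f) =o[𝓝[>] 0]
        fun y : ℝ ↦ y ^ (3 / 4 - ε) := by
  intro f hf ε hε
  set ε' : ℝ := min (ε / 2) (1 / 4) with hε'
  have hε'0 : 0 < ε' := lt_min (by linarith) (by norm_num)
  have hε'1 : ε' ≤ 1 / 4 := min_le_right _ _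
  have hε'ε : ε' < ε := lt_of_le_of_lt (min_le_left _ _) (by linarith)
  have h := verjovskyRate_of_RH hRH hf hε'0 hε'1
  exact h.trans_isLittleO (VerjovskyNecessity.rpow_isLittleO_rpow_nhdsGT' (by linarith))

/-- **Verjovsky 1994, Theorem B 1)** — the named fact `Verjovsky1994_thmB1` DISCHARGED: RH holds
iff `m_y(f) − m₀(f) = o(y^{3/4−ε})` at `0⁺` for every `f ∈ C_c²(ℝ₊ˣ)` and every `ε > 0`
(necessity: this file; sufficiency: `Verjovsky1994_thmB1.mpr_holds`).
[cite: Verjovsky1994, Thm B 1) p. 597] -/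
theorem Verjovsky1994_thmB1_holds : Verjovsky1994_thmB1 :=
  ⟨fun hRH ↦ Verjovsky1994_thmB1.mp_holds hRH, Verjovsky1994_thmB1.mpr_holds⟩

end Literature.NumberTheory.LFunctions
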